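import Mathlib
import HarnessLib
import Summits.NavierStokesRegularity.NavierStokesRegularity.Theses.LocalHelicityTubeDoor
import Summits.NavierStokesRegularity.NavierStokesRegularity.Theorems.LocalHelicityTubeDoorLocalPointZoomVelCurlSlices
import Summits.NavierStokesRegularity.NavierStokesRegularity.Theorems.LocalHelicityTubeDoorFrobeniusProfileRigiditySharper
import Summits.NavierStokesRegularity.NavierStokesRegularity.Theorems.LocalHelicityTubeDoorFrobeniusProfileRigidityScrewSlice
import Summits.NavierStokesRegularity.NavierStokesRegularity.Theorems.LocalHelicityTubeDoorFrobeniusProfileRigidityGermQuadrichotomy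
import Summits.NavierStokesRegularity.NavierStokesRegularity.Theorems.LocalHelicityTubeDoorFrobeniusProfileRigiditySharpest
import Summits.NavierStokesRegularity.NavierStokesRegularity.Theorems.LocalHelicityTubeDoorFrobeniusProfileRigidityExtremal

/-!
# Route `LocalHelicityTubeDoor` (S11, rung N0-LocalTubeDoorHelicity) — the leaf MODULO its one open crux, BY NAME

Cell ns-regularity-ideate, seat p6 (birth filing; support for the leaf item stmt-NavierStokesRegularity-19974 and the crux item stmt-NavierStokesRegularity-19975 —
neither is closed here).  Two by-name reductions against the born Theses decls:

* `target_of_frobeniusProfileRigidity` — **`Target` ⇐ `FrobeniusProfileRigidity`** (the born K2⁗ decl): the gate-certified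
  `closes` with its first binder discharged by the tree theorem `localPointZoomVelCurlSlices` (p437380).  So the rung leaf
  closes the moment K2⁗ does, by `target_of_frobeniusProfileRigidity <K2⁗ proof>`.
* `frobeniusProfileRigidity_of_sharper'` — **the born K2⁗ decl ⇐ the SHARPER RESIDUE** of
  `…FrobeniusProfileRigiditySharper.frobeniusProfileRigidity_of_sharper` (p442523): a K2⁗ prover may assume, on every
  slice, vorticity parallel to no fixed direction, no translation symmetry along any line, axisymmetric-without-swirl
  about no axis, and globally no backward self-similarity about any centre, no time period, no identically vanishing
  velocity component — every excluded alternative is a settled tree stratum.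
* `frobeniusProfileRigidity_of_sliceQuadrichotomy` — **the born K2⁗ decl ⇐ the SLICE QUADRICHOTOMY ALONE** (stub 1 of
  nsreg-p1 g11's BC3 birth skeleton `bc/FrobeniusProfileRigidity_birth.lean`, statement unfolded verbatim): the skeleton's
  composition `FrobeniusProfileRigidity_of` with its stub 2 `ScrewSliceRigidity` DISCHARGED by nsreg-p5 g7's tree theorem
  `…FrobeniusProfileRigidityScrewSlice.eq_zero_of_screwVorticityBall` (p472222) and alternatives 1–3 by the tree strata
  `eq_zero_of_aligned` / `nonflatLiouville_of_translate_eq_slice` / `eq_zero_of_axisymmetric_noSwirl_anyAxis_slice`.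
  So K2⁗ now hinges BY NAME on ONE statement: the quadrichotomy (OPEN).
* `frobeniusProfileRigidity_of_germQuadrichotomy'` / `target_of_germQuadrichotomy` — **the born K2⁗ decl (and the leaf)
  ⇐ the GERM QUADRICHOTOMY** (one slice, one nonempty open window, LOCAL normal forms; tree
  `…FrobeniusProfileRigidityGermQuadrichotomy.frobeniusProfileRigidity_of_germQuadrichotomy`, this seat): the weakest
  registered-able form of stub 1 (what remains is the GLOBAL-TO-GERM statement for profiles of the class).
* `frobeniusProfileRigidity_of_no_extremal'` — **the born K2⁗ decl ⇐ «no extremal helicity-free element of the KNSS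
  Type-I class»** (tree `…FrobeniusProfileRigidityExtremal.frobeniusProfileRigidity_of_no_extremal`, p477139).
* `frobeniusProfileRigidity_of_sharpest'` — **the born K2⁗ decl ⇐ the SHARPEST residue** (19 settled strata excluded;
  tree `…FrobeniusProfileRigiditySharpest.frobeniusProfileRigidity_of_sharpest`, p478367) — obtained by `unfold` +
  `exact`, so the hypothesis list is literally the tree theorem's.

WHAT THIS IS NOT: not a claim about Navier–Stokes regularity (Clay A) and not the open crux K2⁗.  The leaf is a regularity
CRITERION (local Type I + L¹-fading of the scale-normalised helicity density (T−t)^{3/2}·⟪u, curl u⟫ on ONE similarity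
window ⇒ backward bounded) CONDITIONAL on K2⁗ `FrobeniusProfileRigidity` (rigidity of helicity-free Type-I profiles,
OPEN); one rung of LADDER-NS N0 (N0-LocalTubeDoorHelicity); establishment in the cell's sense still requires the
cross-family referee PASS + independent reproduction.
-/

noncomputable section

-- the summit and its single sub-problem share the name (CONVENTIONS §1), as in every Theorems file
set_option linter.dupNamespace false

namespace Summit.NavierStokesRegularity.NavierStokesRegularity.Theorems.LocalHelicityTubeDoorTargetOfProfileRigidity

open scoped RealInnerProductSpace InnerProductSpace Laplacian
open Summit.NavierStokesRegularity.NavierStokesRegularity.Theses.LocalHelicityTubeDoor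
open Summit.NavierStokesRegularity.NavierStokesRegularity.Theorems.LocalHelicityTubeDoorLocalPointZoomVelCurlSlices
open Summit.NavierStokesRegularity.NavierStokesRegularity.Theorems.LocalHelicityTubeDoorFrobeniusProfileRigiditySharper
open Summit.NavierStokesRegularity.NavierStokesRegularity.Theorems.LocalHelicityTubeDoorFrobeniusProfileRigidityScrewSlice
open Summit.NavierStokesRegularity.NavierStokesRegularity.Theorems.LocalHelicityTubeDoorFrobeniusProfileRigidityGermQuadrichotomy
open Summit.NavierStokesRegularity.NavierStokesRegularity.Theorems.LocalHelicityTubeDoorFrobeniusProfileRigiditySharpest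
open Summit.NavierStokesRegularity.NavierStokesRegularity.Theorems.LocalHelicityTubeDoorFrobeniusProfileRigidityExtremal
open Summit.NavierStokesRegularity.NavierStokesRegularity.Theorems.LocalSineTubeDoorProfileAlignedWindowRigidityAncient
open Summit.NavierStokesRegularity.NavierStokesRegularity.Theorems.LocalSineTubeDoorProfileAlignedWindowRigidity
open Summit.NavierStokesRegularity.NavierStokesRegularity.Theorems.PoloidalWindowDoorPoloidalWindowRigidityStrata
open Summit.NavierStokesRegularity.NavierStokesRegularity.Theorems.PoloidalWindowDoorPoloidalWindowRigidityFlat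
open Summit.NavierStokesRegularity.NavierStokesRegularity.Theorems.PoloidalWindowDoorPoloidalWindowRigidityOneSlice
open Summit.NavierStokesRegularity.NavierStokesRegularity.Theorems.LocalHelicityTubeDoorFrobeniusProfileRigidityStrata

/-- **The rung leaf `Target` (item stmt-NavierStokesRegularity-19974) ⇐ the crux K2⁗ `FrobeniusProfileRigidity` (item stmt-NavierStokesRegularity-19975)**,
both BY NAME: `closes` with K1‴ discharged by the tree theorem `localPointZoomVelCurlSlices`. -/
theorem target_of_frobeniusProfileRigidity
    (h : Summit.NavierStokesRegularity.NavierStokesRegularity.Theses.LocalHelicityTubeDoor.FrobeniusProfileRigidity) :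
    Summit.NavierStokesRegularity.NavierStokesRegularity.Theses.LocalHelicityTubeDoor.Target :=
  closes
    (by
      unfold Summit.NavierStokesRegularity.NavierStokesRegularity.Theses.LocalHelicityTubeDoor.LocalPointZoomVelCurlSlices
      exact localPointZoomVelCurlSlices)
    h

/-- **K2⁗ `FrobeniusProfileRigidity` (item stmt-NavierStokesRegularity-19975, the born decl) ⇐ the SHARPER RESIDUE** (p442523
`frobeniusProfileRigidity_of_sharper`, conclusion re-typed as the born decl): it suffices to exclude backward singularity
for the helicity-free profiles of the Type-I class which in addition have, on every slice `s < 0`, vorticity parallel to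
no fixed direction, no translation symmetry along any line and no axisymmetry-without-swirl about any axis, and which are
backward self-similar about no centre, time-periodic with no period, and have no identically vanishing velocity component. -/
theorem frobeniusProfileRigidity_of_sharper'
    (hsharp : ∀ (C : ℝ) (v : ℝ → EuclideanSpace ℝ (Fin 3) → EuclideanSpace ℝ (Fin 3)),
      Literature.Analysis.FluidPDE.HasTypeITimeDecay C v →
      ContinuousOn (Function.uncurry v) (Set.Iio (0 : ℝ) ×ˢ Set.univ) →
      (∀ s t : ℝ, s < t → t < 0 → ∀ x, v t x =
        Literature.Analysis.UnboundedOperators.heatExtension (v s) (t - s) x -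
          Literature.Analysis.FluidPDE.oseenDuhamel 1 s v v t x) →
      (∀ t < 0, Literature.Analysis.FluidPDE.VectorCalculus.IsDivFree (v t)) →
      (∀ s < 0, ∀ y : EuclideanSpace ℝ (Fin 3), ⟪v s y, Literature.Analysis.FluidPDE.curl (v s) y⟫_ℝ = 0) →
      (∀ s < 0, ∀ b : EuclideanSpace ℝ (Fin 3), b ≠ 0 →
        ∃ y, Literature.Analysis.FluidPDE.cross (Literature.Analysis.FluidPDE.curl (v s) y) b ≠ 0) →
      (∀ s < 0, ∀ e : EuclideanSpace ℝ (Fin 3), e ≠ 0 → ∃ (y : EuclideanSpace ℝ (Fin 3)) (l : ℝ),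
        v s (y + l • e) ≠ v s y) →
      (∀ s < 0, ∀ (L : EuclideanSpace ℝ (Fin 3) ≃ₗᵢ[ℝ] EuclideanSpace ℝ (Fin 3)) (c : EuclideanSpace ℝ (Fin 3)),
        ¬ (Literature.Analysis.FluidPDE.IsAxisymmetric (fun y => L.symm (v s (L y + c))) ∧
           Literature.Analysis.FluidPDE.HasNoSwirl (fun y => L.symm (v s (L y + c))))) →
      (∀ c : EuclideanSpace ℝ (Fin 3), ∃ lam : ℝ, 0 < lam ∧ ∃ s < 0, ∃ y,
        lam • v (lam ^ 2 * s) (lam • y + c) ≠ v s (y + c)) →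
      (∀ P : ℝ, 0 < P → ∃ s < 0, ∃ y, v (s - P) y ≠ v s y) →
      (∀ e : EuclideanSpace ℝ (Fin 3), e ≠ 0 → ∃ s < 0, ∃ y, ⟪v s y, e⟫_ℝ ≠ 0) →
      ¬ Literature.Analysis.FluidPDE.IsBackwardSingularPoint v 0) :
    Summit.NavierStokesRegularity.NavierStokesRegularity.Theses.LocalHelicityTubeDoor.FrobeniusProfileRigidity := by
  unfold Summit.NavierStokesRegularity.NavierStokesRegularity.Theses.LocalHelicityTubeDoor.FrobeniusProfileRigidity
  exact frobeniusProfileRigidity_of_sharper hsharp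

/-- **The rung leaf ⇐ the SHARPER RESIDUE** (composition of the two reductions above). -/
theorem target_of_sharper
    (hsharp : ∀ (C : ℝ) (v : ℝ → EuclideanSpace ℝ (Fin 3) → EuclideanSpace ℝ (Fin 3)),
      Literature.Analysis.FluidPDE.HasTypeITimeDecay C v →
      ContinuousOn (Function.uncurry v) (Set.Iio (0 : ℝ) ×ˢ Set.univ) →
      (∀ s t : ℝ, s < t → t < 0 → ∀ x, v t x =
        Literature.Analysis.UnboundedOperators.heatExtension (v s) (t - s) x -
          Literature.Analysis.FluidPDE.oseenDuhamel 1 s v v t x) →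
      (∀ t < 0, Literature.Analysis.FluidPDE.VectorCalculus.IsDivFree (v t)) →
      (∀ s < 0, ∀ y : EuclideanSpace ℝ (Fin 3), ⟪v s y, Literature.Analysis.FluidPDE.curl (v s) y⟫_ℝ = 0) →
      (∀ s < 0, ∀ b : EuclideanSpace ℝ (Fin 3), b ≠ 0 →
        ∃ y, Literature.Analysis.FluidPDE.cross (Literature.Analysis.FluidPDE.curl (v s) y) b ≠ 0) →
      (∀ s < 0, ∀ e : EuclideanSpace ℝ (Fin 3), e ≠ 0 → ∃ (y : EuclideanSpace ℝ (Fin 3)) (l : ℝ),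
        v s (y + l • e) ≠ v s y) →
      (∀ s < 0, ∀ (L : EuclideanSpace ℝ (Fin 3) ≃ₗᵢ[ℝ] EuclideanSpace ℝ (Fin 3)) (c : EuclideanSpace ℝ (Fin 3)),
        ¬ (Literature.Analysis.FluidPDE.IsAxisymmetric (fun y => L.symm (v s (L y + c))) ∧
           Literature.Analysis.FluidPDE.HasNoSwirl (fun y => L.symm (v s (L y + c))))) →
      (∀ c : EuclideanSpace ℝ (Fin 3), ∃ lam : ℝ, 0 < lam ∧ ∃ s < 0, ∃ y,
        lam • v (lam ^ 2 * s) (lam • y + c) ≠ v s (y + c)) →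
      (∀ P : ℝ, 0 < P → ∃ s < 0, ∃ y, v (s - P) y ≠ v s y) →
      (∀ e : EuclideanSpace ℝ (Fin 3), e ≠ 0 → ∃ s < 0, ∃ y, ⟪v s y, e⟫_ℝ ≠ 0) →
      ¬ Literature.Analysis.FluidPDE.IsBackwardSingularPoint v 0) :
    Summit.NavierStokesRegularity.NavierStokesRegularity.Theses.LocalHelicityTubeDoor.Target :=
  target_of_frobeniusProfileRigidity (frobeniusProfileRigidity_of_sharper' hsharp)

/-- **K2⁗ `FrobeniusProfileRigidity` (item stmt-NavierStokesRegularity-19975, the born decl) ⇐ the SLICE QUADRICHOTOMY alone** (stub 1 of the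
BC3 birth skeleton, unfolded verbatim; stub 2 is the tree theorem `eq_zero_of_screwVorticityBall`, p472222): if every
helicity-free profile of the Type-I class has SOME slice `s < 0` on which (1) the vorticity is parallel to a fixed nonzero
direction, or (2) the slice is invariant under the translations along a line, or (3) it is axisymmetric without swirl
about some axis (any direction, any centre), or (4) its vorticity is an affine screw field `k • (d × (y − c) + h • d)`,
`k ≠ 0`, `d ≠ 0`, on a nonempty open set, then K2⁗ holds. -/
theorem frobeniusProfileRigidity_of_sliceQuadrichotomy
    (hquad : ∀ (C : ℝ) (v : ℝ → EuclideanSpace ℝ (Fin 3) → EuclideanSpace ℝ (Fin 3)),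
      (Literature.Analysis.FluidPDE.HasTypeITimeDecay C v ∧
        ContinuousOn (Function.uncurry v) (Set.Iio (0 : ℝ) ×ˢ Set.univ) ∧
        (∀ s t : ℝ, s < t → t < 0 → ∀ x, v t x =
          Literature.Analysis.UnboundedOperators.heatExtension (v s) (t - s) x -
            Literature.Analysis.FluidPDE.oseenDuhamel 1 s v v t x) ∧
        (∀ t < 0, Literature.Analysis.FluidPDE.VectorCalculus.IsDivFree (v t)) ∧
        (∀ s < 0, ∀ y : EuclideanSpace ℝ (Fin 3),
          inner ℝ (v s y) (Literature.Analysis.FluidPDE.curl (v s) y) = 0)) →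
      ∃ s < 0,
        (∃ b : EuclideanSpace ℝ (Fin 3), b ≠ 0 ∧
          ∀ y, Literature.Analysis.FluidPDE.cross (Literature.Analysis.FluidPDE.curl (v s) y) b = 0) ∨
        (∃ e : EuclideanSpace ℝ (Fin 3), e ≠ 0 ∧ ∀ (y : EuclideanSpace ℝ (Fin 3)) (l : ℝ), v s (y + l • e) = v s y) ∨
        (∃ (L : EuclideanSpace ℝ (Fin 3) ≃ₗᵢ[ℝ] EuclideanSpace ℝ (Fin 3)) (c : EuclideanSpace ℝ (Fin 3)),
          Literature.Analysis.FluidPDE.IsAxisymmetric (fun y => L.symm (v s (L y + c))) ∧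
          Literature.Analysis.FluidPDE.HasNoSwirl (fun y => L.symm (v s (L y + c)))) ∨
        (∃ (k : ℝ) (c d : EuclideanSpace ℝ (Fin 3)) (h : ℝ) (U : Set (EuclideanSpace ℝ (Fin 3))),
          k ≠ 0 ∧ d ≠ 0 ∧ IsOpen U ∧ U.Nonempty ∧
          ∀ y ∈ U, Literature.Analysis.FluidPDE.curl (v s) y =
            k • (Literature.Analysis.FluidPDE.cross d (y - c) + h • d))) :
    Summit.NavierStokesRegularity.NavierStokesRegularity.Theses.LocalHelicityTubeDoor.FrobeniusProfileRigidity := by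
  unfold Summit.NavierStokesRegularity.NavierStokesRegularity.Theses.LocalHelicityTubeDoor.FrobeniusProfileRigidity
  intro C v hrate hcont hmild hdiv hhel
  obtain ⟨s, hs, halt⟩ := hquad C v ⟨hrate, hcont, hmild, hdiv, hhel⟩
  rcases halt with ⟨b, hb, hal⟩ | ⟨e, he, htr⟩ | ⟨L, c, hax, hsw⟩ | ⟨k, c, d, h, U, -, -, hU, hne, hsc⟩
  · exact not_backwardSingular_of_zero (eq_zero_of_aligned hrate hcont hmild hdiv hb hs hal)
  · exact nonflatLiouville_of_translate_eq_slice hrate hcont hmild hdiv hs he htr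
  · exact not_backwardSingular_of_zero
      (eq_zero_of_axisymmetric_noSwirl_anyAxis_slice hrate hcont hmild hdiv L c hs hax hsw)
  · exact not_backwardSingular_of_zero
      (eq_zero_of_screwVorticityBall hrate hcont hmild hdiv hs k c d h hU hne hsc)

/-- **The rung leaf ⇐ the SLICE QUADRICHOTOMY** (composition with `target_of_frobeniusProfileRigidity`). -/
theorem target_of_sliceQuadrichotomy
    (hquad : ∀ (C : ℝ) (v : ℝ → EuclideanSpace ℝ (Fin 3) → EuclideanSpace ℝ (Fin 3)),
      (Literature.Analysis.FluidPDE.HasTypeITimeDecay C v ∧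
        ContinuousOn (Function.uncurry v) (Set.Iio (0 : ℝ) ×ˢ Set.univ) ∧
        (∀ s t : ℝ, s < t → t < 0 → ∀ x, v t x =
          Literature.Analysis.UnboundedOperators.heatExtension (v s) (t - s) x -
            Literature.Analysis.FluidPDE.oseenDuhamel 1 s v v t x) ∧
        (∀ t < 0, Literature.Analysis.FluidPDE.VectorCalculus.IsDivFree (v t)) ∧
        (∀ s < 0, ∀ y : EuclideanSpace ℝ (Fin 3),
          inner ℝ (v s y) (Literature.Analysis.FluidPDE.curl (v s) y) = 0)) →
      ∃ s < 0,
        (∃ b : EuclideanSpace ℝ (Fin 3), b ≠ 0 ∧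
          ∀ y, Literature.Analysis.FluidPDE.cross (Literature.Analysis.FluidPDE.curl (v s) y) b = 0) ∨
        (∃ e : EuclideanSpace ℝ (Fin 3), e ≠ 0 ∧ ∀ (y : EuclideanSpace ℝ (Fin 3)) (l : ℝ), v s (y + l • e) = v s y) ∨
        (∃ (L : EuclideanSpace ℝ (Fin 3) ≃ₗᵢ[ℝ] EuclideanSpace ℝ (Fin 3)) (c : EuclideanSpace ℝ (Fin 3)),
          Literature.Analysis.FluidPDE.IsAxisymmetric (fun y => L.symm (v s (L y + c))) ∧
          Literature.Analysis.FluidPDE.HasNoSwirl (fun y => L.symm (v s (L y + c)))) ∨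
        (∃ (k : ℝ) (c d : EuclideanSpace ℝ (Fin 3)) (h : ℝ) (U : Set (EuclideanSpace ℝ (Fin 3))),
          k ≠ 0 ∧ d ≠ 0 ∧ IsOpen U ∧ U.Nonempty ∧
          ∀ y ∈ U, Literature.Analysis.FluidPDE.curl (v s) y =
            k • (Literature.Analysis.FluidPDE.cross d (y - c) + h • d))) :
    Summit.NavierStokesRegularity.NavierStokesRegularity.Theses.LocalHelicityTubeDoor.Target :=
  target_of_frobeniusProfileRigidity (frobeniusProfileRigidity_of_sliceQuadrichotomy hquad)

/-- **K2⁗ `FrobeniusProfileRigidity` (item stmt-NavierStokesRegularity-19975, the born decl) ⇐ the GERM QUADRICHOTOMY** (one slice, one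
nonempty open window, local normal forms — tree `frobeniusProfileRigidity_of_germQuadrichotomy`, conclusion re-typed as
the born decl). -/
theorem frobeniusProfileRigidity_of_germQuadrichotomy'
    (hgerm : ∀ (C : ℝ) (v : ℝ → EuclideanSpace ℝ (Fin 3) → EuclideanSpace ℝ (Fin 3)),
      Literature.Analysis.FluidPDE.HasTypeITimeDecay C v →
      ContinuousOn (Function.uncurry v) (Set.Iio (0 : ℝ) ×ˢ Set.univ) →
      (∀ s t : ℝ, s < t → t < 0 → ∀ x, v t x =
        Literature.Analysis.UnboundedOperators.heatExtension (v s) (t - s) x -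
          Literature.Analysis.FluidPDE.oseenDuhamel 1 s v v t x) →
      (∀ t < 0, Literature.Analysis.FluidPDE.VectorCalculus.IsDivFree (v t)) →
      (∀ s < 0, ∀ y : EuclideanSpace ℝ (Fin 3), ⟪v s y, Literature.Analysis.FluidPDE.curl (v s) y⟫_ℝ = 0) →
      ∃ s < 0, ∃ U : Set (EuclideanSpace ℝ (Fin 3)), IsOpen U ∧ U.Nonempty ∧
        ((∃ b : EuclideanSpace ℝ (Fin 3), b ≠ 0 ∧
            ∀ y ∈ U, Literature.Analysis.FluidPDE.cross (Literature.Analysis.FluidPDE.curl (v s) y) b = 0) ∨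
         (∃ e : EuclideanSpace ℝ (Fin 3), e ≠ 0 ∧ ∀ y ∈ U, fderiv ℝ (v s) y e = 0) ∨
         (∃ (L : EuclideanSpace ℝ (Fin 3) ≃ₗᵢ[ℝ] EuclideanSpace ℝ (Fin 3)) (c : EuclideanSpace ℝ (Fin 3)),
            ∀ y ∈ U, fderiv ℝ (fun y => L.symm (v s (L y + c))) y (Literature.Analysis.FluidPDE.rotGen y) =
                Literature.Analysis.FluidPDE.rotGen (L.symm (v s (L y + c))) ∧
              Literature.Analysis.FluidPDE.swirl (fun y => L.symm (v s (L y + c))) y = 0) ∨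
         (∃ (k : ℝ) (c d : EuclideanSpace ℝ (Fin 3)) (h : ℝ), k ≠ 0 ∧ d ≠ 0 ∧
            ∀ y ∈ U, Literature.Analysis.FluidPDE.curl (v s) y =
              k • (Literature.Analysis.FluidPDE.cross d (y - c) + h • d)))) :
    Summit.NavierStokesRegularity.NavierStokesRegularity.Theses.LocalHelicityTubeDoor.FrobeniusProfileRigidity := by
  unfold Summit.NavierStokesRegularity.NavierStokesRegularity.Theses.LocalHelicityTubeDoor.FrobeniusProfileRigidity
  exact frobeniusProfileRigidity_of_germQuadrichotomy hgerm

/-- **The rung leaf ⇐ the GERM QUADRICHOTOMY** (composition with `target_of_frobeniusProfileRigidity`). -/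
theorem target_of_germQuadrichotomy
    (hgerm : ∀ (C : ℝ) (v : ℝ → EuclideanSpace ℝ (Fin 3) → EuclideanSpace ℝ (Fin 3)),
      Literature.Analysis.FluidPDE.HasTypeITimeDecay C v →
      ContinuousOn (Function.uncurry v) (Set.Iio (0 : ℝ) ×ˢ Set.univ) →
      (∀ s t : ℝ, s < t → t < 0 → ∀ x, v t x =
        Literature.Analysis.UnboundedOperators.heatExtension (v s) (t - s) x -
          Literature.Analysis.FluidPDE.oseenDuhamel 1 s v v t x) →
      (∀ t < 0, Literature.Analysis.FluidPDE.VectorCalculus.IsDivFree (v t)) →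
      (∀ s < 0, ∀ y : EuclideanSpace ℝ (Fin 3), ⟪v s y, Literature.Analysis.FluidPDE.curl (v s) y⟫_ℝ = 0) →
      ∃ s < 0, ∃ U : Set (EuclideanSpace ℝ (Fin 3)), IsOpen U ∧ U.Nonempty ∧
        ((∃ b : EuclideanSpace ℝ (Fin 3), b ≠ 0 ∧
            ∀ y ∈ U, Literature.Analysis.FluidPDE.cross (Literature.Analysis.FluidPDE.curl (v s) y) b = 0) ∨
         (∃ e : EuclideanSpace ℝ (Fin 3), e ≠ 0 ∧ ∀ y ∈ U, fderiv ℝ (v s) y e = 0) ∨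
         (∃ (L : EuclideanSpace ℝ (Fin 3) ≃ₗᵢ[ℝ] EuclideanSpace ℝ (Fin 3)) (c : EuclideanSpace ℝ (Fin 3)),
            ∀ y ∈ U, fderiv ℝ (fun y => L.symm (v s (L y + c))) y (Literature.Analysis.FluidPDE.rotGen y) =
                Literature.Analysis.FluidPDE.rotGen (L.symm (v s (L y + c))) ∧
              Literature.Analysis.FluidPDE.swirl (fun y => L.symm (v s (L y + c))) y = 0) ∨
         (∃ (k : ℝ) (c d : EuclideanSpace ℝ (Fin 3)) (h : ℝ), k ≠ 0 ∧ d ≠ 0 ∧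
            ∀ y ∈ U, Literature.Analysis.FluidPDE.curl (v s) y =
              k • (Literature.Analysis.FluidPDE.cross d (y - c) + h • d)))) :
    Summit.NavierStokesRegularity.NavierStokesRegularity.Theses.LocalHelicityTubeDoor.Target :=
  target_of_frobeniusProfileRigidity (frobeniusProfileRigidity_of_germQuadrichotomy' hgerm)

/-- **K2⁗ `FrobeniusProfileRigidity` (item stmt-NavierStokesRegularity-19975, the born decl) ⇐ «no extremal helicity-free element»** (tree
`frobeniusProfileRigidity_of_no_extremal`, conclusion re-typed as the born decl). -/
theorem frobeniusProfileRigidity_of_no_extremal'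
    (hno : ¬ ∃ (Cs : ℝ) (W : ℝ → EuclideanSpace ℝ (Fin 3) → EuclideanSpace ℝ (Fin 3)), 0 < Cs ∧
      Literature.Analysis.FluidPDE.IsTypeIAncientMild Cs W ∧
      (∀ s < 0, ∀ y, ⟪W s y, Literature.Analysis.FluidPDE.curl (W s) y⟫_ℝ = 0) ∧ ‖W (-1) 0‖ = Cs ∧
      (∀ t < 0, ∀ x, Real.sqrt (-t) * ‖W t x‖ ≤ ‖W (-1) 0‖)) :
    Summit.NavierStokesRegularity.NavierStokesRegularity.Theses.LocalHelicityTubeDoor.FrobeniusProfileRigidity := by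
  unfold Summit.NavierStokesRegularity.NavierStokesRegularity.Theses.LocalHelicityTubeDoor.FrobeniusProfileRigidity
  exact frobeniusProfileRigidity_of_no_extremal hno

/-- **K2⁗ `FrobeniusProfileRigidity` (item stmt-NavierStokesRegularity-19975, the born decl) ⇐ the SHARPEST residue** (tree
`frobeniusProfileRigidity_of_sharpest`: the 19 settled strata of its module docstring excluded, each as a negated
existential; conclusion re-typed as the born decl). -/
theorem frobeniusProfileRigidity_of_sharpest'
    (hres : ∀ (C : ℝ) (v : ℝ → EuclideanSpace ℝ (Fin 3) → EuclideanSpace ℝ (Fin 3)),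
      Literature.Analysis.FluidPDE.HasTypeITimeDecay C v →
      ContinuousOn (Function.uncurry v) (Set.Iio (0 : ℝ) ×ˢ Set.univ) →
      (∀ s t : ℝ, s < t → t < 0 → ∀ x, v t x =
        Literature.Analysis.UnboundedOperators.heatExtension (v s) (t - s) x -
          Literature.Analysis.FluidPDE.oseenDuhamel 1 s v v t x) →
      (∀ t < 0, Literature.Analysis.FluidPDE.VectorCalculus.IsDivFree (v t)) →
      (∀ s < 0, ∀ y : EuclideanSpace ℝ (Fin 3), ⟪v s y, Literature.Analysis.FluidPDE.curl (v s) y⟫_ℝ = 0) →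
      -- (1) no aligned slice (R7)
      (¬ (∃ s < 0, ∃ b : EuclideanSpace ℝ (Fin 3), b ≠ 0 ∧ ∀ y, Literature.Analysis.FluidPDE.cross (Literature.Analysis.FluidPDE.curl (v s) y) b = 0)) →
      -- (2) no translation-invariant slice
      (¬ (∃ s < 0, ∃ e : EuclideanSpace ℝ (Fin 3), e ≠ 0 ∧ ∀ (y : EuclideanSpace ℝ (Fin 3)) (l : ℝ), v s (y + l • e) = v s y)) →
      -- (3) no axisymmetric without swirl about some axis, one slice
      (¬ (∃ s < 0, ∃ (L : EuclideanSpace ℝ (Fin 3) ≃ₗᵢ[ℝ] EuclideanSpace ℝ (Fin 3)) (c : EuclideanSpace ℝ (Fin 3)), Literature.Analysis.FluidPDE.IsAxisymmetric (fun y => L.symm (v s (L y + c))) ∧ Literature.Analysis.FluidPDE.HasNoSwirl (fun y => L.symm (v s (L y + c))))) →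
      -- (4) no backward self-similar about some centre
      (¬ (∃ c : EuclideanSpace ℝ (Fin 3), ∀ lam : ℝ, 0 < lam → ∀ s < 0, ∀ y, lam • v (lam ^ 2 * s) (c + lam • (y - c)) = v s y)) →
      -- (5) no time-periodic
      (¬ (∃ P : ℝ, 0 < P ∧ ∀ s < 0, ∀ y, v (s - P) y = v s y)) →
      -- (6) no one velocity component identically zero (S10's strict shadow)
      (¬ (∃ e : EuclideanSpace ℝ (Fin 3), e ≠ 0 ∧ ∀ s < 0, ∀ y, ⟪v s y, e⟫_ℝ = 0)) →
      -- (7) no GERM: vorticity aligned on a window of one slice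
      (¬ (∃ s < 0, ∃ U : Set (EuclideanSpace ℝ (Fin 3)), IsOpen U ∧ U.Nonempty ∧ ∃ b : EuclideanSpace ℝ (Fin 3), b ≠ 0 ∧ ∀ y ∈ U, Literature.Analysis.FluidPDE.cross (Literature.Analysis.FluidPDE.curl (v s) y) b = 0)) →
      -- (8) no GERM: one directional derivative vanishing on a window of one slice (S13's one-slice crux)
      (¬ (∃ s < 0, ∃ U : Set (EuclideanSpace ℝ (Fin 3)), IsOpen U ∧ U.Nonempty ∧ ∃ e : EuclideanSpace ℝ (Fin 3), e ≠ 0 ∧ ∀ y ∈ U, fderiv ℝ (v s) y e = 0)) →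
      -- (9) no GERM: infinitesimally axisymmetric and swirl-free in some rigid frame on a window of one slice
      (¬ (∃ s < 0, ∃ U : Set (EuclideanSpace ℝ (Fin 3)), IsOpen U ∧ U.Nonempty ∧ ∃ (L : EuclideanSpace ℝ (Fin 3) ≃ₗᵢ[ℝ] EuclideanSpace ℝ (Fin 3)) (c : EuclideanSpace ℝ (Fin 3)), ∀ y ∈ U, fderiv ℝ (fun y => L.symm (v s (L y + c))) y (Literature.Analysis.FluidPDE.rotGen y) = Literature.Analysis.FluidPDE.rotGen (L.symm (v s (L y + c))) ∧ Literature.Analysis.FluidPDE.swirl (fun y => L.symm (v s (L y + c))) y = 0)) →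
      -- (10) no GERM: AFFINE vorticity on a window of one slice (screw fields included)
      (¬ (∃ s < 0, ∃ U : Set (EuclideanSpace ℝ (Fin 3)), IsOpen U ∧ U.Nonempty ∧ ∃ (A : EuclideanSpace ℝ (Fin 3) →L[ℝ] EuclideanSpace ℝ (Fin 3)) (b : EuclideanSpace ℝ (Fin 3)), ∀ y ∈ U, Literature.Analysis.FluidPDE.curl (v s) y = A y + b)) →
      -- (11) no spatially periodic slice
      (¬ (∃ s < 0, ∃ ℓ : EuclideanSpace ℝ (Fin 3), ℓ ≠ 0 ∧ ∀ y, v s (y + ℓ) = v s y)) →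
      -- (12) no helically symmetric slice about some axis, pitch ≠ 0 (swirl allowed)
      (¬ (∃ s < 0, ∃ (L : EuclideanSpace ℝ (Fin 3) ≃ₗᵢ[ℝ] EuclideanSpace ℝ (Fin 3)) (c : EuclideanSpace ℝ (Fin 3)) (h : ℝ), h ≠ 0 ∧ ∀ (θ : ℝ) (y : EuclideanSpace ℝ (Fin 3)), L.symm (v s (L (Literature.Analysis.FluidPDE.rotZ θ y + (h * θ) • Literature.Analysis.FluidPDE.eZ) + c)) = Literature.Analysis.FluidPDE.rotZ θ (L.symm (v s (L y + c))))) →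
      -- (13) no (−1)-homogeneous slice about some centre
      (¬ (∃ s < 0, ∃ c : EuclideanSpace ℝ (Fin 3), ∀ lam : ℝ, 0 < lam → ∀ w : EuclideanSpace ℝ (Fin 3), v s (c + lam • w) = lam⁻¹ • v s (c + w))) →
      -- (14) no slice equivariant under a finite-order rigid screw (rational discrete screw, glide)
      (¬ (∃ s < 0, ∃ (L : EuclideanSpace ℝ (Fin 3) ≃ₗᵢ[ℝ] EuclideanSpace ℝ (Fin 3)) (ℓ : EuclideanSpace ℝ (Fin 3)), ℓ ≠ 0 ∧ L ℓ = ℓ ∧ ∃ n : ℕ, 0 < n ∧ (∀ z, (⇑L)^[n] z = z) ∧ ∀ y, v s (L y + ℓ) = L (v s y))) →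
      -- (15) no VORTICITY translation-invariant along a line on one slice (stratum (A))
      (¬ (∃ s < 0, ∃ e : EuclideanSpace ℝ (Fin 3), e ≠ 0 ∧ ∀ (y : EuclideanSpace ℝ (Fin 3)) (l : ℝ), Literature.Analysis.FluidPDE.curl (v s) (y + l • e) = Literature.Analysis.FluidPDE.curl (v s) y)) →
      -- (16) no HARMONIC vorticity on one slice (stratum (B))
      (¬ (∃ s < 0, ∀ y, (Δ (Literature.Analysis.FluidPDE.curl (v s))) y = 0)) →
      -- (17) no time-periodic VORTICITY
      (¬ (∃ P : ℝ, 0 < P ∧ ∀ s < 0, ∀ y, Literature.Analysis.FluidPDE.curl (v (s - P)) y = Literature.Analysis.FluidPDE.curl (v s) y)) →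
      -- (18) no relative periodic modulo a rigid motion
      (¬ (∃ P : ℝ, 0 < P ∧ ∃ (g : EuclideanSpace ℝ (Fin 3) → EuclideanSpace ℝ (Fin 3)) (L : EuclideanSpace ℝ (Fin 3) ≃ₗᵢ[ℝ] EuclideanSpace ℝ (Fin 3)), ∀ s < 0, ∀ y, v (s - P) (g y) = L (v s y))) →
      -- (19) no scale-invariant size tending to zero in the far past (zoom-out, M9)
      (¬ (∀ ε : ℝ, 0 < ε → ∃ T : ℝ, T < 0 ∧ ∀ t < T, ∀ x, Real.sqrt (-t) * ‖v t x‖ ≤ ε)) →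
      ¬ Literature.Analysis.FluidPDE.IsBackwardSingularPoint v 0) :
    Summit.NavierStokesRegularity.NavierStokesRegularity.Theses.LocalHelicityTubeDoor.FrobeniusProfileRigidity := by
  unfold Summit.NavierStokesRegularity.NavierStokesRegularity.Theses.LocalHelicityTubeDoor.FrobeniusProfileRigidity
  exact frobeniusProfileRigidity_of_sharpest hres

end Summit.NavierStokesRegularity.NavierStokesRegularity.Theorems.LocalHelicityTubeDoorTargetOfProfileRigidity

end
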